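import Literature.NumberTheory.LFunctions.ExceptionalPrimesParameters
import HarnessLib

/-!
# Heath-Brown's lemma, assembly step: from the window bounds to
# `∑_{p ≤ q^{500}} h(p) ≤ 520000 · log q / √(log η)` for an abstract weight

Topic `Literature/NumberTheory/LFunctions`. Everything in this file is PROVED (theorems only);
eighth support file of the elementary proof of Heath-Brown's lemma on exceptional primes
(`ExceptionalPrimesSparse.lean`, `Literature.NumberTheory.LFunctions.SiegelZero.HeathBrown1983_lemma3`).

* the weight `g(n) = (1∗χ)(n) n^{-β}` of a quadratic character: `weight_nonneg`,
  `weight_isMultiplicative`, `weight_prime_pow_le` (`g(p^k) ≤ (k+1)(p^{-β})^k`),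
  `prime_weight_le` (`(1 + χ(p)) log p/p ≤ log p · g(p)` for `β ≤ 1`), `prime_term_bounds`
  (non-negativity and `(1∗χ)(p^k) ≤ k + 1` from the tree's `SmoothEulerProductSandwich.lean`);
* `sum_primesLE_split`, `sum_primesLE_telescope` — splitting a prime sum at `q^4` and over the
  decreasing real thresholds `q^{a_j}`;
* `assembly` — the "linear combination of (3.13) and (3.14) for `m ≤ √log η`" (Tao–Teräväinen,
  remark after Proposition 3.5) with explicit constants: given a multiplicative `g ≥ 0` with
  `g(p^k) ≤ (k+1)(p^{-β})^k`, `q^{4(1−β)} ≤ 1.01`, `L = log q ≥ 6400`, `μ = √(log η) ∈ [3, √(0.3L)]`,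
  and the main-term ratios `ρ₁ ≤ 41/(2η)` on `(q^4, q^{13}]`, `ρ₂ ≤ 1012/η` on `(q^4, q^{4+500}]`
  (`ExceptionalPrimesMainTerm.lean`), every `h` with `h(p) ≤ min(2, p·g(p)) log p/p` at primes has
  `∑_{p ≤ q^{500}} h(p) ≤ 520000 L/μ`: low primes by Mertens (`abs_mertensTau_le`), `J ≤ 11 log μ`
  windows by `window_sum_le` and the decay lemmas of `ExceptionalPrimesParameters.lean`, and the top
  range by `sum_Icc_mul_one_add_sum_prime_le`.

## References

* T. Tao, J. Teräväinen, *The Hardy–Littlewood–Chowla conjecture in the presence of a Siegel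
  zero*, J. London Math. Soc. 106 (2022), §3.3, Proposition 3.5 and the remark following it.
  [TaoTeravainen2021]
* G. H. Hardy, E. M. Wright, *An Introduction to the Theory of Numbers*, Thm 425 (Mertens). [HardyWright2008]
-/

noncomputable section

open Finset ArithmeticFunction
open Literature.NumberTheory.LFunctions.Mertens

namespace Literature.NumberTheory.LFunctions.SiegelZero

/-! ### The weight `g(n) = (1∗χ)(n) n^{-β}` -/

section Weight

variable {q : ℕ} (χ : DirichletCharacter ℂ q) {β : ℝ} {g : ArithmeticFunction ℝ}

/-- `g ≥ 0`. [folklore] -/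
theorem weight_nonneg (hq2 : χ ^ 2 = 1) (hg : ∀ n, g n = (χ.zetaMul n).re * (n : ℝ) ^ (-β))
    (n : ℕ) : 0 ≤ g n := by
  rw [hg]
  exact mul_nonneg (SmoothEulerProduct.zetaMul_re_nonneg χ hq2 n) (Real.rpow_nonneg (Nat.cast_nonneg n) _)

/-- `g` is multiplicative. [folklore] -/
theorem weight_isMultiplicative (hq2 : χ ^ 2 = 1)
    (hg : ∀ n, g n = (χ.zetaMul n).re * (n : ℝ) ^ (-β)) : g.IsMultiplicative := by
  refine ⟨by rw [hg, SmoothEulerProduct.zetaMul_one_re]; simp, fun {m n} hmn => ?_⟩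
  rw [hg, hg, hg, SmoothEulerProduct.zetaMul_re_mul χ hq2 hmn, Nat.cast_mul,
    Real.mul_rpow (Nat.cast_nonneg m) (Nat.cast_nonneg n)]
  ring

/-- `g(p^k) ≤ (k+1) (p^{-β})^k` at prime powers. [folklore] -/
theorem weight_prime_pow_le (hq2 : χ ^ 2 = 1)
    (hg : ∀ n, g n = (χ.zetaMul n).re * (n : ℝ) ^ (-β)) (p k : ℕ) (hp : p.Prime) :
    g (p ^ k) ≤ (k + 1 : ℝ) * ((p : ℝ) ^ (-β)) ^ k := by
  rw [hg]
  have hp0 : (0 : ℝ) ≤ p := Nat.cast_nonneg p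
  have hpk : (((p ^ k : ℕ) : ℝ)) ^ (-β) = ((p : ℝ) ^ (-β)) ^ k := by
    calc (((p ^ k : ℕ) : ℝ)) ^ (-β) = ((p : ℝ) ^ ((k : ℕ) : ℝ)) ^ (-β) := by
          rw [Real.rpow_natCast]; push_cast; rfl
      _ = (p : ℝ) ^ (((k : ℕ) : ℝ) * (-β)) := (Real.rpow_mul hp0 _ _).symm
      _ = (p : ℝ) ^ ((-β) * ((k : ℕ) : ℝ)) := by rw [mul_comm]
      _ = ((p : ℝ) ^ (-β)) ^ ((k : ℕ) : ℝ) := Real.rpow_mul hp0 _ _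
      _ = ((p : ℝ) ^ (-β)) ^ k := Real.rpow_natCast _ _
  rw [hpk]
  exact mul_le_mul_of_nonneg_right (SmoothEulerProduct.zetaMul_prime_pow_re_le χ hq2 hp k)
    (pow_nonneg (Real.rpow_nonneg (Nat.cast_nonneg p) _) k)

/-- At a prime, `(1∗χ)(p) = 1 + χ(p)` and, for `β ≤ 1`,
`(1 + χ(p)) log p / p ≤ log p · g(p)`. [folklore] -/
theorem prime_weight_le (hq2 : χ ^ 2 = 1) (hβ1 : β ≤ 1)
    (hg : ∀ n, g n = (χ.zetaMul n).re * (n : ℝ) ^ (-β)) {p : ℕ} (hp : p.Prime) :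
    (1 + (χ (p : ZMod q)).re) * Real.log p / p ≤ Real.log p * g p := by
  have hp1 : (1 : ℝ) ≤ p := by exact_mod_cast hp.one_lt.le
  have hp0 : (0 : ℝ) < p := by linarith
  have hre : (χ.zetaMul p).re = 1 + (χ (p : ZMod q)).re := by
    have := SmoothEulerProduct.zetaMul_prime_pow_re χ hq2 hp 1
    rw [pow_one] at this
    rw [this]
    simp [Finset.sum_range_succ]
  have hnn : 0 ≤ 1 + (χ (p : ZMod q)).re := by
    rw [← hre]; exact SmoothEulerProduct.zetaMul_re_nonneg χ hq2 p
  have hpow : (p : ℝ)⁻¹ ≤ (p : ℝ) ^ (-β) := by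
    rw [← Real.rpow_neg_one]
    exact Real.rpow_le_rpow_of_exponent_le hp1 (by linarith)
  rw [hg, hre]
  calc (1 + (χ (p : ZMod q)).re) * Real.log p / p
      = Real.log p * ((1 + (χ (p : ZMod q)).re) * (p : ℝ)⁻¹) := by ring
    _ ≤ Real.log p * ((1 + (χ (p : ZMod q)).re) * (p : ℝ) ^ (-β)) := by
        apply mul_le_mul_of_nonneg_left _ (Real.log_nonneg hp1)
        exact mul_le_mul_of_nonneg_left hpow hnn

/-- `0 ≤ (1 + χ(p)) log p / p ≤ 2 log p / p` at a prime. [folklore] -/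
theorem prime_term_bounds {p : ℕ} (hp : p.Prime) :
    0 ≤ (1 + (χ (p : ZMod q)).re) * Real.log p / p ∧
      (1 + (χ (p : ZMod q)).re) * Real.log p / p ≤ 2 * Real.log p / p := by
  have hp1 : (1 : ℝ) ≤ p := by exact_mod_cast hp.one_lt.le
  have hlog : 0 ≤ Real.log p := Real.log_nonneg hp1
  have habs := SmoothEulerProduct.abs_apply_re_le_one χ p
  rw [abs_le] at habs
  constructor
  · apply div_nonneg (mul_nonneg (by linarith [habs.1]) hlog) (by linarith)
  · apply div_le_div_of_nonneg_right _ (by linarith)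
    exact mul_le_mul_of_nonneg_right (by linarith [habs.2]) hlog

end Weight

/-! ### Splitting prime sums -/

/-- `∑_{p ≤ n₂} h(p) = ∑_{p ≤ n₁} h(p) + ∑_{n₁ < p ≤ n₂} h(p)` over primes, `n₁ ≤ n₂`. [folklore] -/
theorem sum_primesLE_split (h : ℕ → ℝ) {n₁ n₂ : ℕ} (hn : n₁ ≤ n₂) :
    ∑ p ∈ Nat.primesLE n₂, h p =
      ∑ p ∈ Nat.primesLE n₁, h p + ∑ p ∈ (Ioc n₁ n₂).filter Nat.Prime, h p := by
  classical
  rw [← Finset.sum_filter_add_sum_filter_not (Nat.primesLE n₂) (fun p => p ≤ n₁) h]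
  congr 1
  · congr 1
    ext p
    simp only [Finset.mem_filter, Nat.mem_primesLE]
    constructor
    · rintro ⟨⟨-, hp⟩, h1⟩; exact ⟨h1, hp⟩
    · rintro ⟨h1, hp⟩; exact ⟨⟨h1.trans hn, hp⟩, h1⟩
  · congr 1
    ext p
    simp only [Finset.mem_filter, Nat.mem_primesLE, Finset.mem_Ioc, not_le]
    constructor
    · rintro ⟨⟨h2, hp⟩, h1⟩; exact ⟨⟨h1, h2⟩, hp⟩
    · rintro ⟨⟨h1, h2⟩, hp⟩; exact ⟨⟨h2, hp⟩, h1⟩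

/-- **Telescoping over decreasing real thresholds**: for `t₀ ≥ t₁ ≥ ⋯ ≥ 0`,
`∑_{p ≤ t₀} h(p) = ∑_{p ≤ t_J} h(p) + ∑_{j < J} ∑_{t_{j+1} < p ≤ t_j} h(p)`. [folklore] -/
theorem sum_primesLE_telescope (h : ℕ → ℝ) (t : ℕ → ℝ) (ht0 : ∀ j, 0 ≤ t j)
    (hmono : ∀ j, t (j + 1) ≤ t j) (J : ℕ) :
    ∑ p ∈ Nat.primesLE ⌊t 0⌋₊, h p =
      ∑ p ∈ Nat.primesLE ⌊t J⌋₊, h p +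
        ∑ j ∈ range J, ∑ p ∈ (Nat.primesLE ⌊t j⌋₊).filter (fun p : ℕ => t (j + 1) < (p : ℝ)), h p := by
  induction J with
  | zero => simp
  | succ J ih =>
    rw [Finset.sum_range_succ, sum_primesLE_filter_lt_eq_sub h (ht0 (J + 1)) (hmono J), ih]
    ring

/-! ### The assembly, for an abstract weight -/

/-- **The assembly step** (the "linear combination of (3.13) and (3.14) for `m ≤ √log η`"): let
`g ≥ 0` be multiplicative with `g(p^k) ≤ (k+1)(p^{−β})^k`, `β ≤ 1`, `q ≥ 3` with `q^{4(1−β)} ≤ 1.01`,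
`L = log q ≥ 6400`; let `h(p) ≤ 2 log p/p` with `h(p) ≤ log p · g(p)` at primes; let `μ ≥ 3`
with `μ² = log η ≤ 0.3 L`, `μ ≤ η`, `η ≥ 41`; and suppose the weight of `g` on `(q^4, q^{13}]`, resp.
`(q^4, q^{4+500}]`, is at most `ρ₁`, resp. `ρ₂`, times its weight on `[1, q^4]` (`> 0`), where
`2ρ₁ ≤ 41/η`, `ρ₂ ≤ 1012/η`. Then `∑_{p ≤ q^{500}} h(p) ≤ 520000 · L/μ`.
[cite: TaoTeravainen2021, §3.3, remark after Proposition 3.5] -/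
theorem assembly {g : ArithmeticFunction ℝ} (hg : g.IsMultiplicative) (hg0 : ∀ n, 0 ≤ g n)
    {h : ℕ → ℝ} (hh2 : ∀ p, p.Prime → h p ≤ 2 * Real.log p / p)
    (hhg : ∀ p, p.Prime → h p ≤ Real.log p * g p)
    {q : ℕ} (hq3 : 3 ≤ q) {β : ℝ} (hβ1 : β ≤ 1)
    (hgpk : ∀ p k : ℕ, p.Prime → 1 ≤ k → g (p ^ k) ≤ (k + 1 : ℝ) * ((p : ℝ) ^ (-β)) ^ k)
    (hq4β : (q : ℝ) ^ (4 * (1 - β)) ≤ 101 / 100)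
    {L : ℝ} (hL : L = Real.log q) (hL6400 : 6400 ≤ L)
    {η μ : ℝ} (hμ2 : μ ^ 2 = Real.log η) (hμ3 : 3 ≤ μ) (hμL : μ ^ 2 ≤ 3 / 10 * L) (hμη : μ ≤ η)
    (hη41 : 41 ≤ η)
    {ρ₁ ρ₂ : ℝ} (hρ₁0 : 0 ≤ ρ₁) (hρ₁ : 2 * ρ₁ ≤ 41 / η) (hρ₂ : ρ₂ ≤ 1012 / η)
    (hbase : 0 < ∑ n ∈ Icc 1 (q ^ 4), g n)
    (h13 : ∑ N ∈ Ioc (q ^ 4) (q ^ 13), g N ≤ ρ₁ * ∑ n ∈ Icc 1 (q ^ 4), g n)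
    (h504 : ∑ N ∈ Ioc (q ^ 4) (q ^ (4 + 500)), g N ≤ ρ₂ * ∑ n ∈ Icc 1 (q ^ 4), g n) :
    ∑ p ∈ Nat.primesLE (q ^ 500), h p ≤ 520000 * (L / μ) := by
  classical
  -- sizes
  have hq0 : (0 : ℝ) < q := by exact_mod_cast lt_of_lt_of_le (by norm_num) hq3
  have hq1 : (1 : ℝ) < q := by exact_mod_cast lt_of_lt_of_le (by norm_num) hq3
  have hq1n : 1 ≤ q := by omega
  have hL0 : 0 < L := by linarith
  have hμ0 : 0 < μ := by linarith
  have hμ1 : 1 ≤ μ := by linarith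
  have hη0 : 0 < η := by linarith
  have hμL' : μ ≤ L := by nlinarith
  have hLμ : 80 * μ ≤ L := by nlinarith
  set G4 : ℝ := ∑ n ∈ Icc 1 (q ^ 4), g n with hG4def
  -- the window scheme
  set J : ℕ := ⌊Real.log μ / Real.log (11 / 10)⌋₊ with hJdef
  obtain ⟨hJ1, hJ2, hJ3⟩ := geomIndex_bounds hμ1
  rw [← hJdef] at hJ1 hJ2 hJ3
  set a : ℕ → ℝ := fun j => 4 * (10 / 11 : ℝ) ^ j with hadef
  set t : ℕ → ℝ := fun j => (q : ℝ) ^ (a j) with htdef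
  obtain ⟨haJlo, haJhi⟩ := lastExponent_bounds hμ0 hJ1 hJ2
  have ha0 : ∀ j, 0 < a j := fun j => by simp only [hadef]; positivity
  have ht0 : ∀ j, 0 ≤ t j := fun j => (Real.rpow_pos_of_pos hq0 _).le
  have hmono : ∀ j, t (j + 1) ≤ t j := fun j =>
    Real.rpow_le_rpow_of_exponent_le hq1.le (le_of_lt (window_params j).2.1)
  have ht00 : ⌊t 0⌋₊ = q ^ 4 := by
    have : t 0 = ((q ^ 4 : ℕ) : ℝ) := by
      simp only [htdef, hadef, pow_zero, mul_one]
      rw [show (4 : ℝ) = ((4 : ℕ) : ℝ) by norm_num, Real.rpow_natCast]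
      push_cast; ring
    rw [this, Nat.floor_natCast]
  have hlogt : ∀ j, Real.log (t j) = a j * L := fun j => by
    simp only [htdef]; rw [Real.log_rpow hq0, hL]
  -- Step 1: the top range `(q^4, q^{500}]`
  have htop : ∑ p ∈ (Ioc (q ^ 4) (q ^ 500)).filter Nat.Prime, h p ≤ 506000 * (L / μ) := by
    -- `∑ g(p) ≤ ρ₂`
    have hprod := sum_Icc_mul_one_add_sum_prime_le hg hg0 (Y := q ^ 4) (Z := q ^ 500)
      (one_le_pow₀ hq1n) (pow_le_pow_right₀ hq1n (by norm_num))
    have hsplit : ∑ n ∈ Icc 1 (q ^ 4 * q ^ 500), g n =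
        G4 + ∑ N ∈ Ioc (q ^ 4) (q ^ (4 + 500)), g N := by
      have hI : ∀ K : ℕ, Finset.Icc 1 K = Finset.Ioc 0 K := fun K => by
        ext n; simp only [Finset.mem_Icc, Finset.mem_Ioc]; omega
      rw [← pow_add, hG4def, hI, hI,
        Finset.sum_Ioc_consecutive _ (Nat.zero_le _)
          (pow_le_pow_right₀ hq1n (Nat.le_add_right 4 500))]
    have hS : ∑ p ∈ (Ioc (q ^ 4) (q ^ 500)).filter Nat.Prime, g p ≤ ρ₂ := by
      have h1 : G4 * (1 + ∑ p ∈ (Ioc (q ^ 4) (q ^ 500)).filter Nat.Prime, g p) ≤ G4 * (1 + ρ₂) := by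
        calc G4 * (1 + ∑ p ∈ (Ioc (q ^ 4) (q ^ 500)).filter Nat.Prime, g p)
            = (∑ n ∈ Icc 1 (q ^ 4), g n) *
                (1 + ∑ p ∈ (Ioc (q ^ 4) (q ^ 500)).filter Nat.Prime, g p) := by rw [hG4def]
          _ ≤ ∑ n ∈ Icc 1 (q ^ 4 * q ^ 500), g n := hprod
          _ = G4 + ∑ N ∈ Ioc (q ^ 4) (q ^ (4 + 500)), g N := hsplit
          _ ≤ G4 + ρ₂ * G4 := by linarith
          _ = G4 * (1 + ρ₂) := by ring
      have := le_of_mul_le_mul_left h1 hbase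
      linarith
    -- `h(p) ≤ 500 L g(p)` on the range
    have hterm : ∀ p ∈ (Ioc (q ^ 4) (q ^ 500)).filter Nat.Prime, h p ≤ 500 * L * g p := by
      intro p hp
      simp only [Finset.mem_filter, Finset.mem_Ioc] at hp
      have hpp := hp.2
      have hp0 : (0 : ℝ) < p := by exact_mod_cast hpp.pos
      have hlogp : Real.log p ≤ 500 * L := by
        have h1 : (p : ℝ) ≤ (q : ℝ) ^ 500 := by
          have h2 := (Nat.cast_le (α := ℝ)).mpr hp.1.2
          rwa [Nat.cast_pow] at h2
        calc Real.log p ≤ Real.log ((q : ℝ) ^ 500) := Real.log_le_log hp0 h1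
          _ = 500 * L := by rw [Real.log_pow, hL]; push_cast; ring
      exact (hhg p hpp).trans (mul_le_mul_of_nonneg_right hlogp (hg0 p))
    have hρ₂' : ρ₂ ≤ 1012 / μ := hρ₂.trans (div_le_div_of_nonneg_left (by norm_num) hμ0 hμη)
    calc ∑ p ∈ (Ioc (q ^ 4) (q ^ 500)).filter Nat.Prime, h p
        ≤ ∑ p ∈ (Ioc (q ^ 4) (q ^ 500)).filter Nat.Prime, 500 * L * g p := Finset.sum_le_sum hterm
      _ = 500 * L * ∑ p ∈ (Ioc (q ^ 4) (q ^ 500)).filter Nat.Prime, g p := by rw [Finset.mul_sum]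
      _ ≤ 500 * L * (1012 / μ) := by gcongr; exact hS.trans hρ₂'
      _ = 506000 * (L / μ) := by ring
  -- Step 2: one window
  have hQ : (q : ℝ) ^ (-(a J)) ≤ Real.exp (-μ) := by
    rw [Real.rpow_def_of_pos hq0, Real.exp_le_exp, ← hL]
    have : μ ≤ L * a J := by
      calc μ = μ ^ 2 / μ := by field_simp
        _ ≤ (4 * L) / μ := div_le_div_of_nonneg_right (by nlinarith) hμ0.le
        _ = L * (4 / μ) := by ring
        _ ≤ L * a J := mul_le_mul_of_nonneg_left haJlo hL0.le
    linarith
  have h2ρ₁le1 : 2 * ρ₁ ≤ 1 := hρ₁.trans ((div_le_one hη0).mpr hη41)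
  have hB : (2 * ρ₁) ^ (1 / (μ + 1)) ≤ Real.exp (2 - μ) := by
    rcases hρ₁0.eq_or_lt with h0 | hpos
    · rw [← h0, mul_zero, Real.zero_rpow (one_div_pos.mpr (by linarith)).ne']
      exact (Real.exp_pos _).le
    · refine rpow_inv_le_exp_of_log_le (by linarith) (by linarith) ?_
      rw [hμ2]
      calc Real.log (2 * ρ₁) ≤ Real.log (41 / η) := Real.log_le_log (by linarith) hρ₁
        _ = Real.log 41 - Real.log η := Real.log_div (by norm_num) hη0.ne'
  have hwindow : ∀ j, j < J →
      ∑ p ∈ (Nat.primesLE ⌊t j⌋₊).filter (fun p : ℕ => t (j + 1) < (p : ℝ)), h p ≤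
        42 / 5 * L * (Real.exp (2 - μ) + 202 / 100 * Real.exp (-μ)) := by
    intro j hj
    obtain ⟨ha'0, haa', ha4, hratio, hm2, hlow, hup⟩ := window_params j
    set m : ℕ := ⌈(11 / 10 : ℝ) ^ (j + 1)⌉₊ with hmdef
    have hm1 : 1 ≤ m := by omega
    have hmμ : (m : ℝ) ≤ μ + 1 := ceil_pow_le_of_lt hj hJ1
    -- `a' L ≥ 320`
    have ha'J : a J ≤ a (j + 1) := by
      simp only [hadef]
      exact mul_le_mul_of_nonneg_left (pow_ratio_le_of_lt hj) (by norm_num)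
    have ha'L : 320 ≤ a (j + 1) * L := by
      have : 4 / μ * L ≤ a (j + 1) * L := mul_le_mul_of_nonneg_right (haJlo.trans ha'J) hL0.le
      have h2 : 320 ≤ 4 / μ * L := by
        rw [div_mul_eq_mul_div, le_div_iff₀ hμ0]; linarith
      linarith
    -- the window bound for `g`
    have ha'L' : 320 ≤ 4 * (10 / 11 : ℝ) ^ (j + 1) * Real.log q := by rw [← hL]; exact ha'L
    have hW := window_sum_le hg hg0 hq3 hβ1 hgpk hq4β ha'0 haa' ha4 hratio ha'L' hm2 hlow
      (hup.trans (by norm_num)) hρ₁0 hbase h13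
    -- pass to `h`: `h(p) ≤ a_j L g(p)` on the window
    have hterm : ∀ p ∈ (Nat.primesLE ⌊t j⌋₊).filter (fun p : ℕ => t (j + 1) < (p : ℝ)),
        h p ≤ a j * L * g p := by
      intro p hp
      simp only [Finset.mem_filter, Nat.mem_primesLE] at hp
      have hpp := hp.1.2
      have hp0 : (0 : ℝ) < p := by exact_mod_cast hpp.pos
      have hlogp : Real.log p ≤ a j * L := by
        have h1 : (p : ℝ) ≤ t j := (Nat.cast_le.mpr hp.1.1).trans (Nat.floor_le (ht0 j))
        rw [← hlogt]
        exact Real.log_le_log hp0 h1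
      exact (hhg p hpp).trans (mul_le_mul_of_nonneg_right hlogp (hg0 p))
    have hsumh : ∑ p ∈ (Nat.primesLE ⌊t j⌋₊).filter (fun p : ℕ => t (j + 1) < (p : ℝ)), h p ≤
        a j * L * ∑ p ∈ (Nat.primesLE ⌊t j⌋₊).filter (fun p : ℕ => t (j + 1) < (p : ℝ)), g p := by
      rw [Finset.mul_sum]; exact Finset.sum_le_sum hterm
    -- simplify the window bound
    have hρpow : (2 * ρ₁) ^ (1 / (m : ℝ)) ≤ Real.exp (2 - μ) :=
      (rpow_inv_le_rpow_inv (by positivity) h2ρ₁le1 hm1 hmμ).trans hB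
    have hqa' : (q : ℝ) ^ (-(a (j + 1))) ≤ Real.exp (-μ) :=
      (Real.rpow_le_rpow_of_exponent_le hq1.le (neg_le_neg ha'J)).trans hQ
    have hm0 : (0 : ℝ) ≤ m := Nat.cast_nonneg m
    have hWsimp : ∑ p ∈ (Nat.primesLE ⌊t j⌋₊).filter (fun p : ℕ => t (j + 1) < (p : ℝ)), g p ≤
        m * (Real.exp (2 - μ) + 202 / 100 * Real.exp (-μ)) := by
      refine hW.trans ?_
      have h1 : (m : ℝ) * (2 * ρ₁) ^ (1 / (m : ℝ)) ≤ m * Real.exp (2 - μ) :=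
        mul_le_mul_of_nonneg_left hρpow hm0
      have h2 : ((m : ℝ) - 1) * (202 / 100 * (q : ℝ) ^ (-(a (j + 1)))) ≤
          m * (202 / 100 * Real.exp (-μ)) := by
        have hx : 0 ≤ 202 / 100 * (q : ℝ) ^ (-(a (j + 1))) := by positivity
        calc ((m : ℝ) - 1) * (202 / 100 * (q : ℝ) ^ (-(a (j + 1))))
            ≤ m * (202 / 100 * (q : ℝ) ^ (-(a (j + 1)))) :=
              mul_le_mul_of_nonneg_right (by linarith) hx
          _ ≤ m * (202 / 100 * Real.exp (-μ)) := by gcongr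
      linarith
    have hajm : a j * m ≤ 42 / 5 := hup
    have hX : 0 ≤ Real.exp (2 - μ) + 202 / 100 * Real.exp (-μ) := by positivity
    calc ∑ p ∈ (Nat.primesLE ⌊t j⌋₊).filter (fun p : ℕ => t (j + 1) < (p : ℝ)), h p
        ≤ a j * L * (m * (Real.exp (2 - μ) + 202 / 100 * Real.exp (-μ))) :=
          hsumh.trans (mul_le_mul_of_nonneg_left hWsimp (by positivity))
      _ = (a j * m) * L * (Real.exp (2 - μ) + 202 / 100 * Real.exp (-μ)) := by ring
      _ ≤ 42 / 5 * L * (Real.exp (2 - μ) + 202 / 100 * Real.exp (-μ)) := by gcongr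
  -- Step 3: all windows
  have hwindows : ∑ j ∈ range J,
      ∑ p ∈ (Nat.primesLE ⌊t j⌋₊).filter (fun p : ℕ => t (j + 1) < (p : ℝ)), h p ≤ 5326 * (L / μ) := by
    refine (sum_range_le_mul hwindow).trans ?_
    have hda := windows_decay_a (by linarith : (2 : ℝ) ≤ μ)
    have hdb := windows_decay_b (by linarith : (2 : ℝ) ≤ μ)
    have hlogμ0 : 0 ≤ Real.log μ := Real.log_nonneg hμ1
    have hX : 0 ≤ 42 / 5 * L * (Real.exp (2 - μ) + 202 / 100 * Real.exp (-μ)) := by positivity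
    calc (J : ℝ) * (42 / 5 * L * (Real.exp (2 - μ) + 202 / 100 * Real.exp (-μ)))
        ≤ (11 * Real.log μ) * (42 / 5 * L * (Real.exp (2 - μ) + 202 / 100 * Real.exp (-μ))) :=
          mul_le_mul_of_nonneg_right hJ3 hX
      _ = 42 / 5 * L * (11 * Real.log μ * Real.exp (2 - μ) +
            11 * Real.log μ * (202 / 100 * Real.exp (-μ))) := by ring
      _ ≤ 42 / 5 * L * (500 / μ + 134 / μ) := by gcongr
      _ = 26628 / 5 * (L / μ) := by ring
      _ ≤ 5326 * (L / μ) := mul_le_mul_of_nonneg_right (by norm_num) (by positivity)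
  -- Step 4: the low range `p ≤ q^{a_J}`
  have hlow : ∑ p ∈ Nat.primesLE ⌊t J⌋₊, h p ≤ 84 / 5 * (L / μ) := by
    have ht1 : 1 ≤ t J := Real.one_le_rpow hq1.le (ha0 J).le
    have hM := abs_mertensTau_le ht1
    unfold mertensTau primeLogDivSum at hM
    rw [abs_le, hlogt] at hM
    have h1 : ∑ p ∈ Nat.primesLE ⌊t J⌋₊, h p ≤ 2 * ∑ p ∈ Nat.primesLE ⌊t J⌋₊, Real.log p / p := by
      rw [Finset.mul_sum]
      refine Finset.sum_le_sum fun p hp => ?_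
      have := hh2 p (Nat.prime_of_mem_primesLE hp)
      rw [mul_div_assoc] at this
      exact this
    have haJL : a J * L ≤ 44 / 10 / μ * L := mul_le_mul_of_nonneg_right haJhi.le hL0.le
    have h8 : (8 : ℝ) ≤ 8 * (L / μ) := by
      have : 1 ≤ L / μ := by rw [le_div_iff₀ hμ0]; linarith
      linarith
    calc ∑ p ∈ Nat.primesLE ⌊t J⌋₊, h p ≤ 2 * (a J * L + 4) := by linarith [hM.2]
      _ ≤ 2 * (44 / 10 / μ * L + 4) := by linarith
      _ = 44 / 5 * (L / μ) + 8 := by ring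
      _ ≤ 44 / 5 * (L / μ) + 8 * (L / μ) := by linarith
      _ = 84 / 5 * (L / μ) := by ring
  -- Step 5: decomposition and conclusion
  have hdecomp : ∑ p ∈ Nat.primesLE (q ^ 500), h p =
      ∑ p ∈ Nat.primesLE ⌊t J⌋₊, h p +
      ∑ j ∈ range J, ∑ p ∈ (Nat.primesLE ⌊t j⌋₊).filter (fun p : ℕ => t (j + 1) < (p : ℝ)), h p +
      ∑ p ∈ (Ioc (q ^ 4) (q ^ 500)).filter Nat.Prime, h p := by
    rw [sum_primesLE_split h (pow_le_pow_right₀ hq1n (by norm_num : 4 ≤ 500)), ← ht00,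
      sum_primesLE_telescope h t ht0 hmono J]
  rw [hdecomp]
  have hLμ0 : 0 ≤ L / μ := by positivity
  linarith

end Literature.NumberTheory.LFunctions.SiegelZero

end
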